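import Literature.Claims.NS.GeorgievDavidi2021
import Mathlib.Analysis.Calculus.BumpFunction.InnerProduct
import HarnessLib

/-!
# NS-claims map, C31 `GeorgievDavidi2021` (arXiv:1806.10081 v10, NS paper pp. 1–26): kernel refutation of the
# compactness sentence p.12 l.9–11 (Step 4 of the typed skeleton `Literature.Claims.NS.GeorgievDavidi2021`)

Locator (skeleton typist-4 g2, p474043; REF ref-3 g2, RETYPE.md §5): «By the construction of X¹ and Y¹, we have
that X¹ is a compact subset of Y¹ and Y¹ is a compact subset of C¹([0,1],C₀²(D_j))» (v10 p.12 l.9–11; again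
p.18 l.61 for [1,2]) — the «Y nonempty compact» hypothesis of the authors' Theorem 2.3 at its NS instantiation
(p.13 l.40). `Y¹` is the closed ball of radius `(1+ε)M_{1j}` of the space `E¹` of `C¹([0,1],C₀²(D_j))`-functions
supported in the core `D_jj`, for the norm `‖f‖ = max{sup|f|, sup|f_t|, sup|f_x|, sup|f_xx|, sup|f_y|, sup|f_yy|,
sup|f_z|, sup|f_zz|}`; the skeleton types «compact» in its weakest form `BallCompact`: every `‖·‖`-bounded sequence
of `E` has a `‖·‖`-Cauchy subsequence.

* `exists_smooth_bounded_not_cauchy` — **the witness**: for any cell `D` (bounded) and core `K` containing a closed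
  ball `closedBall x₀ r` with `x₀ ∈ D`, any interval `[a,a+1]` and any radius `R > 0`, the jointly smooth sequence
  `f_n(t,x) = c · β(x) · sin(2π·2ⁿ(t − a)) / (2π·2ⁿ)` (`β` a smooth bump, `= 1` near `x₀`, supported in
  `ball x₀ r`; `c = R/B` with `B` a bound for `β`'s first two derivatives on `D̄`) lies in `E`, has `‖f_n‖ ≤ R`, and
  NO `‖·‖`-Cauchy subsequence: `∂_t f_n(t,x₀) = c·cos(2π·2ⁿ(t − a))`, and for `m > n` at `t = a + 2^{-(m+1)}` the two
  cosines are `−1` and `cos(π/2^{m−n}) ≥ 0`, so `sup|∂_t(f_m − f_n)| ≥ c` for every pair — a closed norm-ball of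
  the infinite-dimensional space `E¹` is not compact (Riesz), made explicit.
* `not_Step4Cell` — refutes the skeleton's cell-grain Step 4 (`Step4Cell`, consumed by `claim_of_steps_cell`) at the
  cell `D = ball 0 2`, core `K = closedBall 0 1`, base point `e₀ ∈ ∂K`, `[0,1]`, `R = 1`.
* `not_Step4CellPrint` — the same witness refutes the referee's PRINT-CLASS restriction (ref-3 g2, RETYPE.md §5.1 F1
  note: sequences jointly `C^∞`, i.e. inside `E¹` under every reading of `C¹([0,1],C₀²(D_j))`); the body of ref-3's
  `Retype.Step4CellPrint` is inlined verbatim as the negated proposition (no new `def : Prop` in this file).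
* `not_Step4_compact` (decomposition grain, the decl consumed by `claim_of_steps`) is in the companion file
  `SoloRefuteGeorgievDavidi2021Decomp.lean` (which imports this one: explicit admissible decomposition of ℝ³ into
  half-open unit cubes, zero datum — the authors' own Remark 1.2 case).

Classification (cell vocabulary): false lemma (countermodel) at p.12 l.9–11; load-bearing Theorem 1.1 (p.3 l.13 –
p.4 l.61) is left without its printed proof. Axioms: `propext`, `Classical.choice`, `Quot.sound`.
WHAT THIS IS NOT: not a claim about NS regularity or blow-up; not a claim about any author beyond the typed locator.
-/

set_option linter.dupNamespace false

noncomputable section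

namespace Summit.NavierStokesRegularity.NavierStokesRegularity.Theorems.GeorgievDavidi2021

open scoped ContDiff
open Set Filter Topology Metric Real
open Literature.Claims.NS.GeorgievDavidi2021

/-- `ℝ³`. -/
abbrev E3 : Type := EuclideanSpace ℝ (Fin 3)

/-- The `k`-th unit vector. -/
abbrev ev (k : Fin 3) : E3 := EuclideanSpace.single k (1 : ℝ)

/-! ## The witness family -/

/-- A smooth bump centred at `x₀`: `= 1` on `closedBall x₀ (r/2)`, supported in `ball x₀ r`. -/
def bump (x₀ : E3) {r : ℝ} (hr : 0 < r) : ContDiffBump x₀ :=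
  ⟨r / 2, r, by positivity, by linarith⟩

/-- Time profiles `ψ_n(t) = sin(2π·2ⁿ(t − a)) / (2π·2ⁿ)`. -/
def psi (a : ℝ) (n : ℕ) (t : ℝ) : ℝ :=
  Real.sin (2 * π * 2 ^ n * (t - a)) / (2 * π * 2 ^ n)

/-- Their derivatives `ψ_n'(t) = cos(2π·2ⁿ(t − a))`. -/
def dpsi (a : ℝ) (n : ℕ) (t : ℝ) : ℝ :=
  Real.cos (2 * π * 2 ^ n * (t - a))

/-- `0 < 2π·2ⁿ`. -/
theorem two_pi_pow_pos (n : ℕ) : 0 < 2 * π * (2 : ℝ) ^ n := by positivity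

/-- `ψ_n' = dpsi`. -/
theorem hasDerivAt_psi (a : ℝ) (n : ℕ) (t : ℝ) : HasDerivAt (psi a n) (dpsi a n t) t := by
  have hk := two_pi_pow_pos n
  have h1 : HasDerivAt (fun s : ℝ => 2 * π * 2 ^ n * (s - a)) (2 * π * 2 ^ n) t := by
    simpa using ((hasDerivAt_id t).sub_const a).const_mul (2 * π * 2 ^ n)
  have h2 := (Real.hasDerivAt_sin _).comp t h1
  have h3 := h2.div_const (2 * π * 2 ^ n)
  have : Real.cos (2 * π * 2 ^ n * (t - a)) * (2 * π * 2 ^ n) / (2 * π * 2 ^ n) = dpsi a n t := by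
    rw [dpsi, mul_div_assoc, div_self hk.ne', mul_one]
  rw [this] at h3
  exact h3

/-- `ψ_n` is smooth. -/
theorem contDiff_psi (a : ℝ) (n : ℕ) : ContDiff ℝ ∞ (psi a n) := by
  unfold psi
  exact (Real.contDiff_sin.comp (contDiff_const.mul (contDiff_id.sub contDiff_const))).div_const _

/-- `|ψ_n| ≤ 1`. -/
theorem abs_psi_le (a : ℝ) (n : ℕ) (t : ℝ) : |psi a n t| ≤ 1 := by
  have hk := two_pi_pow_pos n
  rw [psi, abs_div, abs_of_pos hk]
  have h1 : |Real.sin (2 * π * 2 ^ n * (t - a))| ≤ 1 := Real.abs_sin_le_one _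
  have h2 : (1 : ℝ) ≤ 2 * π * 2 ^ n := by
    have hπ : (3 : ℝ) < π := Real.pi_gt_three
    have hp : (1 : ℝ) ≤ 2 ^ n := one_le_pow₀ (by norm_num)
    nlinarith
  rw [div_le_one hk]
  linarith

/-- `|ψ_n'| ≤ 1`. -/
theorem abs_dpsi_le (a : ℝ) (n : ℕ) (t : ℝ) : |dpsi a n t| ≤ 1 := Real.abs_cos_le_one _

/-- SEPARATION: for `n < m`, at `t = a + 2^{-(m+1)}`: `ψ_m' = cos π = −1`, `ψ_n' = cos(π/2^{m−n}) ≥ 0`. -/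
theorem dpsi_sep (a : ℝ) {n m : ℕ} (hnm : n < m) :
    1 ≤ |dpsi a m (a + 1 / 2 ^ (m + 1)) - dpsi a n (a + 1 / 2 ^ (m + 1))| := by
  have hm : dpsi a m (a + 1 / 2 ^ (m + 1)) = -1 := by
    rw [dpsi]
    have : 2 * π * (2 : ℝ) ^ m * (a + 1 / 2 ^ (m + 1) - a) = π := by
      have h2 : (2 : ℝ) ^ (m + 1) ≠ 0 := by positivity
      field_simp
      ring
    rw [this, Real.cos_pi]
  have hn : 0 ≤ dpsi a n (a + 1 / 2 ^ (m + 1)) := by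
    rw [dpsi]
    obtain ⟨d, hd⟩ := Nat.exists_eq_add_of_lt hnm
    -- m = n + d + 1
    have harg : 2 * π * (2 : ℝ) ^ n * (a + 1 / 2 ^ (m + 1) - a) = π / 2 ^ (d + 1) := by
      rw [hd]
      have : (2 : ℝ) ^ (n + d + 1 + 1) = 2 ^ n * 2 ^ (d + 1) * 2 := by ring
      rw [this]
      have h2 : (2 : ℝ) ^ n ≠ 0 := by positivity
      have h3 : (2 : ℝ) ^ (d + 1) ≠ 0 := by positivity
      field_simp
      ring
    rw [harg]
    have hpos : (0 : ℝ) < π / 2 ^ (d + 1) := by positivity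
    have hle : π / 2 ^ (d + 1) ≤ π / 2 := by
      apply div_le_div_of_nonneg_left Real.pi_pos.le two_pos
      calc (2 : ℝ) = 2 ^ 1 := by norm_num
        _ ≤ 2 ^ (d + 1) := pow_le_pow_right₀ (by norm_num) (by omega)
    exact Real.cos_nonneg_of_neg_pi_div_two_le_of_le (by linarith) hle
  rw [hm]
  rw [abs_of_nonpos (by linarith)]
  linarith

/-- the separation time `a + 2^{-(m+1)}` lies in `[a, a+1]` -/
theorem sep_point_mem (a : ℝ) (m : ℕ) : a + 1 / 2 ^ (m + 1) ∈ Icc a (a + 1) := by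
  constructor
  · have : (0 : ℝ) < 1 / 2 ^ (m + 1) := by positivity
    linarith
  · have : 1 / (2 : ℝ) ^ (m + 1) ≤ 1 := by
      rw [div_le_one (by positivity)]
      exact one_le_pow₀ (by norm_num)
    linarith

section Witness

variable (x₀ : E3) {r : ℝ} (hr : 0 < r) (a c : ℝ)

/-- **The witness** `f_n(t,x) = c · β(x) · ψ_n(t)`. -/
def wit (n : ℕ) (t : ℝ) (x : E3) : ℝ :=
  c * bump x₀ hr x * psi a n t

/-- first spatial derivatives of the bump along `e_k` -/
def bump1 (k : Fin 3) (x : E3) : ℝ := fderiv ℝ (bump x₀ hr) x (ev k)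

/-- second pure spatial derivatives of the bump along `e_k` -/
def bump2 (k : Fin 3) (x : E3) : ℝ := fderiv ℝ (bump1 x₀ hr k) x (ev k)

/-- the bump is smooth -/
theorem bump_contDiff : ContDiff ℝ ∞ (bump x₀ hr : E3 → ℝ) := (bump x₀ hr).contDiff

/-- its first partials are smooth -/
theorem bump1_contDiff (k : Fin 3) : ContDiff ℝ ∞ (bump1 x₀ hr k) := by
  have h := (contDiff_infty_iff_fderiv.1 (bump_contDiff x₀ hr)).2
  exact h.clm_apply contDiff_const

/-- its second pure partials are continuous -/
theorem bump2_continuous (k : Fin 3) : Continuous (bump2 x₀ hr k) := by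
  have h := (contDiff_infty_iff_fderiv.1 (bump1_contDiff x₀ hr k)).2
  exact (h.clm_apply contDiff_const).continuous

/-- the witness is jointly smooth on `ℝ × ℝ³` -/
theorem wit_smooth (n : ℕ) : ContDiff ℝ ∞ (Function.uncurry (wit x₀ hr a c n)) := by
  have h1 : ContDiff ℝ ∞ (fun q : ℝ × E3 => bump x₀ hr q.2) := (bump_contDiff x₀ hr).comp contDiff_snd
  have h2 : ContDiff ℝ ∞ (fun q : ℝ × E3 => psi a n q.1) := (contDiff_psi a n).comp contDiff_fst
  exact (contDiff_const.mul h1).mul h2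

/-- the time-`t` slice of the witness as `const · β` -/
theorem wit_apply (n : ℕ) (t : ℝ) : wit x₀ hr a c n t = fun x => (c * psi a n t) * bump x₀ hr x := by
  funext x; simp only [wit]; ring

/-- first spatial partials of the witness -/
theorem pd_wit (n : ℕ) (t : ℝ) (k : Fin 3) :
    pd k (wit x₀ hr a c n t) = fun x => (c * psi a n t) * bump1 x₀ hr k x := by
  funext x
  rw [pd, wit_apply, fderiv_const_mul ((bump_contDiff x₀ hr).differentiable (by simp)).differentiableAt]
  rfl

/-- second pure spatial partials of the witness -/
theorem pd_pd_wit (n : ℕ) (t : ℝ) (k : Fin 3) :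
    pd k (pd k (wit x₀ hr a c n t)) = fun x => (c * psi a n t) * bump2 x₀ hr k x := by
  funext x
  rw [pd_wit, pd, fderiv_const_mul ((bump1_contDiff x₀ hr k).differentiable (by simp)).differentiableAt]
  rfl

/-- time derivative of the witness -/
theorem hasDerivAt_wit_time (n : ℕ) (x : E3) (t : ℝ) :
    HasDerivAt (fun s => wit x₀ hr a c n s x) (c * bump x₀ hr x * dpsi a n t) t := by
  unfold wit
  exact (hasDerivAt_psi a n t).const_mul _

/-- the one-sided time derivative on `[a,a+1]` used by the norm `‖·‖` -/
theorem derivWithin_wit_time (n : ℕ) (x : E3) {t : ℝ} (ht : t ∈ Icc a (a + 1)) :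
    derivWithin (fun s => wit x₀ hr a c n s x) (Icc a (a + 1)) t = c * bump x₀ hr x * dpsi a n t :=
  ((hasDerivAt_wit_time x₀ hr a c n x t).hasDerivWithinAt).derivWithin
    (uniqueDiffOn_Icc (by linarith) t ht)

/-- membership in the class `E(K, [a,a+1])` when the bump's ball lies in the core -/
theorem wit_inE {K : Set E3} (hK : closedBall x₀ r ⊆ K) (n : ℕ) : InE K a (wit x₀ hr a c n) where
  c1 := ((wit_smooth x₀ hr a c n).of_le (by exact_mod_cast le_top)).contDiffOn
  c2 t _ := by
    rw [wit_apply]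
    exact contDiff_const.mul (bump x₀ hr).contDiff
  cont1 k := by
    have : (fun q : ℝ × E3 => pd k (wit x₀ hr a c n q.1) q.2) =
        fun q => (c * psi a n q.1) * bump1 x₀ hr k q.2 := by
      funext q; rw [pd_wit]
    rw [this]
    exact ((contDiff_const.mul ((contDiff_psi a n).comp contDiff_fst)).continuous.mul
      ((bump1_contDiff x₀ hr k).continuous.comp continuous_snd)).continuousOn
  cont2 k := by
    have : (fun q : ℝ × E3 => pd k (pd k (wit x₀ hr a c n q.1)) q.2) =
        fun q => (c * psi a n q.1) * bump2 x₀ hr k q.2 := by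
      funext q; rw [pd_pd_wit]
    rw [this]
    exact ((contDiff_const.mul ((contDiff_psi a n).comp contDiff_fst)).continuous.mul
      ((bump2_continuous x₀ hr k).comp continuous_snd)).continuousOn
  support t _ x hx := by
    have hx' : x ∉ closedBall x₀ r := fun h => hx (hK h)
    have hzero : bump x₀ hr x = 0 := by
      apply (bump x₀ hr).zero_of_le_dist
      rw [mem_closedBall, not_le] at hx'
      exact hx'.le
    simp [wit, hzero]

end Witness

/-- **The witness theorem.** A bounded cell `D`, a core `K ⊇ closedBall x₀ r` with `x₀ ∈ D`, any `[a,a+1]`, any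
`R > 0`: a jointly smooth sequence in `E(K)` with `‖f_n‖ ≤ R` and no `‖·‖`-Cauchy subsequence. -/
theorem exists_smooth_bounded_not_cauchy {D K : Set E3} {x₀ : E3} {r : ℝ} (hr : 0 < r)
    (hK : closedBall x₀ r ⊆ K) (hx₀ : x₀ ∈ D) (hD : Bornology.IsBounded D) (a : ℝ) {R : ℝ} (hR : 0 < R) :
    ∃ f : ℕ → ℝ → E3 → ℝ, (∀ n, ContDiff ℝ ∞ (Function.uncurry (f n))) ∧ (∀ n, InE K a (f n)) ∧
      (∀ n, NormLe D a (f n) R) ∧ ¬ HasNormCauchySubseq D a f := by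
  -- bounds for the bump's first and second derivatives on the compact closure of `D`
  have hcl : IsCompact (closure D) := hD.isCompact_closure
  obtain ⟨C₁, hC₁⟩ := hcl.exists_bound_of_continuousOn
    (f := fun x => fderiv ℝ (bump x₀ hr : E3 → ℝ) x)
    (((bump_contDiff x₀ hr).continuous_fderiv (by simp)).continuousOn)
  have hb2 : ∀ k : Fin 3, ∃ C : ℝ, ∀ x ∈ closure D, ‖bump2 x₀ hr k x‖ ≤ C := fun k =>
    hcl.exists_bound_of_continuousOn ((bump2_continuous x₀ hr k).continuousOn)
  choose C₂ hC₂ using hb2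
  set B : ℝ := max 1 (max C₁ (max (C₂ 0) (max (C₂ 1) (C₂ 2)))) with hB
  have hB1 : 1 ≤ B := le_max_left _ _
  have hBpos : 0 < B := lt_of_lt_of_le one_pos hB1
  have hC₁B : C₁ ≤ B := le_trans (le_max_left _ _) (le_max_right _ _)
  have hC₂B : ∀ k : Fin 3, C₂ k ≤ B := by
    intro k
    fin_cases k
    · exact le_trans (le_max_left _ _) (le_trans (le_max_right _ _) (le_max_right _ _))
    · exact le_trans (le_max_left _ _)
        (le_trans (le_max_right _ _) (le_trans (le_max_right _ _) (le_max_right _ _)))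
    · exact le_trans (le_max_right _ _)
        (le_trans (le_max_right _ _) (le_trans (le_max_right _ _) (le_max_right _ _)))
  set c : ℝ := R / B with hc
  have hcpos : 0 < c := div_pos hR hBpos
  have hcR : c ≤ R := by
    rw [hc, div_le_iff₀ hBpos]; nlinarith
  have hcB : c * B = R := by rw [hc]; field_simp
  refine ⟨wit x₀ hr a c, wit_smooth x₀ hr a c, wit_inE x₀ hr a c hK, ?_, ?_⟩
  · -- the norm bound `‖f_n‖ ≤ R`
    intro n t ht x hx
    have hxc : x ∈ closure D := subset_closure hx
    have hβ : |bump x₀ hr x| ≤ 1 := by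
      rw [abs_of_nonneg (bump x₀ hr).nonneg]; exact (bump x₀ hr).le_one
    have hψ := abs_psi_le a n t
    have hψ' := abs_dpsi_le a n t
    refine ⟨?_, ?_, fun k => ⟨?_, ?_⟩⟩
    · rw [wit, abs_mul, abs_mul, abs_of_pos hcpos]
      calc c * |bump x₀ hr x| * |psi a n t| ≤ c * 1 * 1 := by gcongr
        _ ≤ R := by linarith
    · rw [derivWithin_wit_time x₀ hr a c n x ht, abs_mul, abs_mul, abs_of_pos hcpos]
      calc c * |bump x₀ hr x| * |dpsi a n t| ≤ c * 1 * 1 := by gcongr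
        _ ≤ R := by linarith
    · rw [pd_wit]
      have h1 : |bump1 x₀ hr k x| ≤ B := by
        have hle : |bump1 x₀ hr k x| ≤ ‖fderiv ℝ (bump x₀ hr : E3 → ℝ) x‖ := by
          rw [bump1, ← Real.norm_eq_abs]
          calc ‖fderiv ℝ (bump x₀ hr : E3 → ℝ) x (ev k)‖
              ≤ ‖fderiv ℝ (bump x₀ hr : E3 → ℝ) x‖ * ‖ev k‖ := ContinuousLinearMap.le_opNorm _ _
            _ = ‖fderiv ℝ (bump x₀ hr : E3 → ℝ) x‖ := by simp
        exact le_trans hle (le_trans (hC₁ x hxc) hC₁B)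
      show |c * psi a n t * bump1 x₀ hr k x| ≤ R
      rw [abs_mul, abs_mul, abs_of_pos hcpos]
      calc c * |psi a n t| * |bump1 x₀ hr k x| ≤ c * 1 * B := by gcongr
        _ = R := by rw [mul_one, hcB]
    · rw [pd_pd_wit]
      have h2 : |bump2 x₀ hr k x| ≤ B := by
        have := hC₂ k x hxc
        rw [Real.norm_eq_abs] at this
        exact le_trans this (hC₂B k)
      show |c * psi a n t * bump2 x₀ hr k x| ≤ R
      rw [abs_mul, abs_mul, abs_of_pos hcpos]
      calc c * |psi a n t| * |bump2 x₀ hr k x| ≤ c * 1 * B := by gcongr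
        _ = R := by rw [mul_one, hcB]
  · -- no `‖·‖`-Cauchy subsequence: `sup|∂_t(f_{φ(N+1)} − f_{φ N})| ≥ c` at `x₀`
    rintro ⟨φ, hφ, hC⟩
    obtain ⟨N, hN⟩ := hC (c / 2) (by positivity)
    have hlt : φ N < φ (N + 1) := hφ (Nat.lt_succ_self N)
    set t₀ : ℝ := a + 1 / 2 ^ (φ (N + 1) + 1) with ht₀
    have ht₀mem : t₀ ∈ Icc a (a + 1) := sep_point_mem a _
    have hNle := (hN (N + 1) N (Nat.le_succ N) le_rfl) t₀ ht₀mem x₀ hx₀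
    have hderiv := hNle.2.1
    -- compute the time derivative of the difference at `(t₀, x₀)`
    have hβ0 : bump x₀ hr x₀ = 1 :=
      (bump x₀ hr).one_of_mem_closedBall (mem_closedBall_self (by simp [bump]; positivity))
    have hd : HasDerivAt (fun s => wit x₀ hr a c (φ (N + 1)) s x₀ - wit x₀ hr a c (φ N) s x₀)
        (c * bump x₀ hr x₀ * dpsi a (φ (N + 1)) t₀ - c * bump x₀ hr x₀ * dpsi a (φ N) t₀) t₀ :=
      (hasDerivAt_wit_time x₀ hr a c (φ (N + 1)) x₀ t₀).sub
        (hasDerivAt_wit_time x₀ hr a c (φ N) x₀ t₀)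
    have hdw : derivWithin (fun s => wit x₀ hr a c (φ (N + 1)) s x₀ - wit x₀ hr a c (φ N) s x₀)
        (Icc a (a + 1)) t₀ = c * bump x₀ hr x₀ * dpsi a (φ (N + 1)) t₀ - c * bump x₀ hr x₀ * dpsi a (φ N) t₀ :=
      hd.hasDerivWithinAt.derivWithin (uniqueDiffOn_Icc (by linarith) t₀ ht₀mem)
    have hval : c * bump x₀ hr x₀ * dpsi a (φ (N + 1)) t₀ - c * bump x₀ hr x₀ * dpsi a (φ N) t₀ =
        c * (dpsi a (φ (N + 1)) t₀ - dpsi a (φ N) t₀) := by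
      rw [hβ0]; ring
    rw [hdw, hval, abs_mul, abs_of_pos hcpos] at hderiv
    have hsep := dpsi_sep a hlt
    rw [← ht₀] at hsep
    have : c * 1 ≤ c * |dpsi a (φ (N + 1)) t₀ - dpsi a (φ N) t₀| := by gcongr
    linarith

/-- No norm-ball of `E(K)` over a bounded cell with a fat core is (relatively) compact. -/
theorem not_ballCompact {D K : Set E3} {x₀ : E3} {r : ℝ} (hr : 0 < r) (hK : closedBall x₀ r ⊆ K)
    (hx₀ : x₀ ∈ D) (hD : Bornology.IsBounded D) (a : ℝ) {R : ℝ} (hR : 0 < R) : ¬ BallCompact D K a R := by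
  intro h
  obtain ⟨f, -, hE, hN, hnc⟩ := exists_smooth_bounded_not_cauchy hr hK hx₀ hD a hR
  exact hnc (h f hE hN)

/-! ## The cell instance: `D = ball 0 2`, `K = closedBall 0 1`, base point `e₀` -/

/-- `‖e₀‖ = 1` -/
theorem e0_norm : ‖(ev 0 : E3)‖ = 1 := by simp

/-- the core `closedBall 0 1` is a proper subset of the cell `ball 0 2` (`(3/2)e₀`) -/
theorem closedBall_ne_ball : (closedBall (0 : E3) 1) ≠ ball (0 : E3) 2 := by
  intro h
  have hmem : ((3 / 2 : ℝ) • ev 0 : E3) ∈ ball (0 : E3) 2 := by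
    rw [mem_ball, dist_zero_right, norm_smul, e0_norm]; norm_num
  rw [← h, mem_closedBall, dist_zero_right, norm_smul, e0_norm] at hmem
  norm_num at hmem

/-- the base point `e₀` lies on `∂(closedBall 0 1)` -/
theorem e0_mem_frontier : (ev 0 : E3) ∈ frontier (closedBall (0 : E3) 1) := by
  rw [frontier_closedBall (0 : E3) one_ne_zero, mem_sphere, dist_zero_right, e0_norm]

/-- **Refutes `Step4Cell`** (Step 4 at cell grain, p.12 l.9–11; consumed by `claim_of_steps_cell`): the norm-ball of
radius `1` of `E(closedBall 0 1)` over the cell `ball 0 2` on `[0,1]` has a bounded sequence with no Cauchy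
subsequence. -/
theorem not_Step4Cell : ¬ Step4Cell := by
  intro h
  have hvol : 0 < MeasureTheory.volume (ball (0 : E3) 2) := measure_ball_pos _ _ two_pos
  have hBC := h (ball (0 : E3) 2) (closedBall (0 : E3) 1) (ev 0) 0 1 isBounded_ball measurableSet_ball hvol
    (isCompact_closedBall _ _) (closedBall_subset_ball one_lt_two) closedBall_ne_ball e0_mem_frontier one_pos
  exact not_ballCompact (x₀ := 0) (r := 1) one_pos subset_rfl (mem_ball_self two_pos) isBounded_ball 0 one_pos
    hBC

/-- **Refutes the referee's PRINT-CLASS restriction of `Step4Cell` too** (ns-claims-ref-3 g2, RETYPE.md §5.1 F1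
note — `Retype.Step4CellPrint` of `HOME/ns-claims-ref-3/retype-GeorgievDavidi2021.lean`, its body inlined here
verbatim: the same sentence for sequences that are jointly `C^∞`, i.e. inside the print's `E¹` under every reading
of `C¹([0,1],C₀²(D_j))`): the witness sequence is jointly smooth. -/
theorem not_Step4CellPrint :
    ¬ (∀ (D K : Set E3) (b : E3) (a R : ℝ),
        Bornology.IsBounded D → MeasurableSet D → 0 < MeasureTheory.volume D → IsCompact K → K ⊆ D → K ≠ D →
        b ∈ frontier K → 0 < R →
        ∀ f : ℕ → ℝ → E3 → ℝ, (∀ n, ContDiff ℝ ∞ (Function.uncurry (f n))) → (∀ n, InE K a (f n)) →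
          (∀ n, NormLe D a (f n) R) → HasNormCauchySubseq D a f) := by
  intro h
  have hvol : 0 < MeasureTheory.volume (ball (0 : E3) 2) := measure_ball_pos _ _ two_pos
  obtain ⟨f, hs, hE, hN, hnc⟩ := exists_smooth_bounded_not_cauchy (D := ball (0 : E3) 2)
    (K := closedBall (0 : E3) 1) (x₀ := 0) (r := 1) one_pos subset_rfl (mem_ball_self two_pos) isBounded_ball
    0 one_pos
  exact hnc (h (ball (0 : E3) 2) (closedBall (0 : E3) 1) (ev 0) 0 1 isBounded_ball measurableSet_ball hvol
    (isCompact_closedBall _ _) (closedBall_subset_ball one_lt_two) closedBall_ne_ball e0_mem_frontier one_pos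
    f hs hE hN)

end Summit.NavierStokesRegularity.NavierStokesRegularity.Theorems.GeorgievDavidi2021

end
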